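/-
# Graph equations — translation circuits (the straight-line programs of the translates)

Supporting kernel for the crux `MultiplicityReduction` of route `GraphEquations`
(hand 1 = `BoundedOrderPurification` at `K = 2`, beneath the registered line `purisplit`).
First half of the discharge of the ROUTINE plumbing statement `TranslatesPlumbing` of M17b
(`GraphEquationsUntwistingResidual`): the program of ONE translate `t ∘ τ_δ`, built from the program
of `t` by composing ELEMENTARY translations through the tree's substitution of straight-line programs
(`ArithCircuit.substCircuit`, Bürgisser 2000, Rem. 2.7).  The system-level assembly and the theorem
`translatesPlumbing` are in `GraphEquationsTranslationPlumbing`.  No sorry.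
-/
import Mathlib
import Summits.MatrixMultiplication.Statement
import Summits.MatrixMultiplication.MatrixMultiplication.Theorems.GraphEquationsUntwistingResidual

/-!
# The construction (one translate)

A base translation `δ = (A₁, B₁)` is the sum of its ELEMENTARY pieces `δ_v e_v`, `v ∈ supp δ`
(`supportList`, `deltaOf_supportList`), and `τ_δ` is the composite of the elementary translations
(`translate_translate`: `translate δ₂ ∘ translate δ₁ = translate (δ₁ + δ₂)` — the translations
commute; `translate_zero`).  An elementary translation by `c` at the entry `v = a_{ik}` moves only
`a_{ik} ↦ a_{ik} + c` and `c_{il} ↦ c_{il} + c·b_{kl}` (`l < n`); at `v = b_{kl}` only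
`b_{kl} ↦ b_{kl} + c` and `c_{il} ↦ c_{il} + c·a_{ik}` (`i < n`).  So one elementary step costs
`n + 1` INPUT GATES of fan-in two reading variables only (`elemGates`, values `elemVals`,
`gateValues_append_elemGates`), after which the previous program is re-read with these inputs
substituted for the moved variables (`elemRho`, `eval_elemRho`; `ArithCircuit.substCircuit`, whose
gate values are the `aeval`-images of the old ones: `gateValues_substCircuit_gates`).  Iterating over
the pieces (`translCircuit P L`) gives a fan-in-two program of size `(n+1)·|L| + |P|`
(`size_translCircuit`, `isFanInTwo_translCircuit`) whose last `|P|` gates hold the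
`deltaOf L`-translates of the values of `P` (**`getD_gateValues_translCircuit`**); with
`L = supportList δ` (`|L| = |supp δ|`, `length_supportList`) these are the `δ`-translates.

References: Bürgisser 2000, *Completeness and Reduction in Algebraic Complexity Theory*, Rem. 2.7
(substitution of straight-line programs); BCS97 Problem 16.3.
-/

open scoped BigOperators

noncomputable section

set_option linter.dupNamespace false

namespace Summit.MatrixMultiplication.MatrixMultiplication.Theorems.GraphEquations

open MvPolynomial Literature.Computability.AlgebraicComplexity
open Literature.Computability.AlgebraicComplexity.ArithCircuit

variable {n : ℕ}


/-! ## Translations compose additively -/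

/-- `translate δ 0 = 0`. -/
@[simp] theorem translate_zero_right (δ : MatMulVars n → ℂ) :
    translate δ (0 : MvPolynomial (GraphVars n) ℂ) = 0 :=
  map_zero (bind₁ (shift (graphPoint δ)))

/-- The `c_{il}`-coordinate of `τ_δ x`, as one sum. -/
theorem shiftPoint_graphPoint_inr (δ : MatMulVars n → ℂ) (x : GraphVars n → ℂ) (i l : Fin n) :
    shiftPoint (graphPoint δ) x (Sum.inr (i, l)) = x (Sum.inr (i, l)) +
      ∑ j : Fin n, (δ (Sum.inl (i, j)) * δ (Sum.inr (j, l)) +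
        δ (Sum.inl (i, j)) * x (Sum.inl (Sum.inr (j, l))) + δ (Sum.inr (j, l)) * x (Sum.inl (Sum.inl (i, j)))) := by
  simp only [shiftPoint, shift, graphPoint, map_add, map_sum, MvPolynomial.eval_X, MvPolynomial.eval_C,
    MvPolynomial.smul_eval]
  rw [add_assoc, ← Finset.sum_add_distrib]
  congr 1
  exact Finset.sum_congr rfl fun j _ => by ring

/-- The `(A,B)`-coordinates of `τ_δ x`. -/
theorem shiftPoint_graphPoint_inl (δ : MatMulVars n → ℂ) (x : GraphVars n → ℂ) (v : MatMulVars n) :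
    shiftPoint (graphPoint δ) x (Sum.inl v) = x (Sum.inl v) + δ v := by
  simp [shiftPoint, shift, graphPoint]

/-- `τ_0 = id`. -/
theorem shiftPoint_graphPoint_zero (x : GraphVars n → ℂ) :
    shiftPoint (graphPoint (0 : MatMulVars n → ℂ)) x = x := by
  funext v
  rcases v with v | ⟨i, l⟩
  · simp [shiftPoint_graphPoint_inl]
  · simp [shiftPoint_graphPoint_inr]

/-- `translate 0 = id`. -/
theorem translate_zero (t : MvPolynomial (GraphVars n) ℂ) : translate (0 : MatMulVars n → ℂ) t = t :=
  MvPolynomial.funext fun x => by rw [eval_translate, shiftPoint_graphPoint_zero]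

/-- **The translations form a commutative group action**: `τ_{δ₁} (τ_{δ₂} x) = τ_{δ₁ + δ₂} x`. -/
theorem shiftPoint_graphPoint_comp (δ₁ δ₂ : MatMulVars n → ℂ) (x : GraphVars n → ℂ) :
    shiftPoint (graphPoint δ₁) (shiftPoint (graphPoint δ₂) x) = shiftPoint (graphPoint (δ₁ + δ₂)) x := by
  funext v
  rcases v with v | ⟨i, l⟩
  · simp only [shiftPoint_graphPoint_inl, Pi.add_apply]
    ring
  · simp only [shiftPoint_graphPoint_inr, shiftPoint_graphPoint_inl, Pi.add_apply]
    rw [add_assoc, ← Finset.sum_add_distrib]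
    congr 1
    exact Finset.sum_congr rfl fun j _ => by ring

/-- **`translate δ₂ ∘ translate δ₁ = translate (δ₁ + δ₂)`.** -/
theorem translate_translate (δ₁ δ₂ : MatMulVars n → ℂ) (t : MvPolynomial (GraphVars n) ℂ) :
    translate δ₂ (translate δ₁ t) = translate (δ₁ + δ₂) t := by
  apply MvPolynomial.funext
  intro x
  rw [eval_translate, eval_translate, eval_translate, shiftPoint_graphPoint_comp]

/-- `aeval (shift (graphPoint δ)) = translate δ` (`bind₁ = aeval`, definitional). -/
theorem aeval_shift_graphPoint (δ : MatMulVars n → ℂ) (t : MvPolynomial (GraphVars n) ℂ) :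
    aeval (shift (graphPoint δ)) t = translate δ t := rfl

/-! ## Elementary translations: the input gates -/

/-- The input gate `a_v + c` (resp. `b_v + c`) of the elementary translation by `c` at `v`. -/
def elemInGate (v : MatMulVars n) (c : ℂ) : Gate ℂ (GraphVars n) :=
  .sum [(1, .var (Sum.inl v)), (c, .const 1)]

/-- The translated `c`-inputs of the elementary translation by `c` at `v`: at `v = a_{ik}` the gates
`c_{il} + c·b_{kl}` (`l < n`), at `v = b_{kl}` the gates `c_{il} + c·a_{ik}` (`i < n`). -/
def elemCGate : MatMulVars n → ℂ → Fin n → Gate ℂ (GraphVars n)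
  | Sum.inl (i, k), c, l => .sum [(1, .var (Sum.inr (i, l))), (c, .var (Sum.inl (Sum.inr (k, l))))]
  | Sum.inr (k, l), c, i => .sum [(1, .var (Sum.inr (i, l))), (c, .var (Sum.inl (Sum.inl (i, k))))]

/-- Their values. -/
def elemCVal : MatMulVars n → ℂ → Fin n → MvPolynomial (GraphVars n) ℂ
  | Sum.inl (i, k), c, l => X (Sum.inr (i, l)) + c • X (Sum.inl (Sum.inr (k, l)))
  | Sum.inr (k, l), c, i => X (Sum.inr (i, l)) + c • X (Sum.inl (Sum.inl (i, k)))

/-- The `n + 1` input gates of an elementary translation. -/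
def elemGates (v : MatMulVars n) (c : ℂ) : List (Gate ℂ (GraphVars n)) :=
  elemInGate v c :: List.ofFn (elemCGate v c)

/-- Their values. -/
def elemVals (v : MatMulVars n) (c : ℂ) : List (MvPolynomial (GraphVars n) ℂ) :=
  (X (Sum.inl v) + C c) :: List.ofFn (elemCVal v c)

/-- `n + 1` input gates. -/
@[simp] theorem length_elemGates (v : MatMulVars n) (c : ℂ) : (elemGates v c).length = n + 1 := by
  simp [elemGates]

/-- `n + 1` input values. -/
@[simp] theorem length_elemVals (v : MatMulVars n) (c : ℂ) : (elemVals v c).length = n + 1 := by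
  simp [elemVals]

/-- The input gates have fan-in two. -/
theorem fanIn_elemGates (v : MatMulVars n) (c : ℂ) : ∀ g ∈ elemGates v c, g.fanIn ≤ 2 := by
  intro g hg
  simp only [elemGates, List.mem_cons, List.mem_ofFn] at hg
  rcases hg with rfl | ⟨l, rfl⟩
  · simp [elemInGate, Gate.fanIn, Gate.args]
  · rcases v with ⟨i, k⟩ | ⟨k, l'⟩ <;> simp [elemCGate, Gate.fanIn, Gate.args]

/-- The input gate reads variables only: its value does not depend on the earlier gates. -/
theorem eval_elemInGate (v : MatMulVars n) (c : ℂ) (vals : List (MvPolynomial (GraphVars n) ℂ)) :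
    (elemInGate v c).eval vals = X (Sum.inl v) + C c := by
  simp [elemInGate, Gate.eval, Operand.eval, MvPolynomial.smul_eq_C_mul]

/-- The `c`-input gates read variables only. -/
theorem eval_elemCGate (v : MatMulVars n) (c : ℂ) (l : Fin n) (vals : List (MvPolynomial (GraphVars n) ℂ)) :
    (elemCGate v c l).eval vals = elemCVal v c l := by
  rcases v with ⟨i, k⟩ | ⟨k, l'⟩ <;> simp [elemCGate, elemCVal, Gate.eval, Operand.eval]

/-- Appending gates whose values do not depend on the earlier gates. -/
theorem gateValues_append_of_eval_eq (G hs : List (Gate ℂ (GraphVars n)))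
    (w : Gate ℂ (GraphVars n) → MvPolynomial (GraphVars n) ℂ)
    (H : ∀ g ∈ hs, ∀ vals, g.eval vals = w g) : gateValues (G ++ hs) = gateValues G ++ hs.map w := by
  induction hs using List.reverseRecOn with
  | nil => simp
  | append_singleton hs g ih =>
    rw [← List.append_assoc, gateValues_append_singleton,
      ih (fun g' hg' => H g' (List.mem_append_left _ hg')), H g (by simp), List.map_append,
      List.map_singleton, List.append_assoc]

/-- **Values of the input gates** (after any prefix). -/
theorem gateValues_append_elemGates (G : List (Gate ℂ (GraphVars n))) (v : MatMulVars n) (c : ℂ) :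
    gateValues (G ++ elemGates v c) = gateValues G ++ elemVals v c := by
  rw [gateValues_append_of_eval_eq G (elemGates v c) (fun g => g.eval []) (fun g hg vals => ?_)]
  · simp [elemGates, elemVals, List.map_ofFn, Function.comp_def, eval_elemInGate, eval_elemCGate]
  · simp only [elemGates, List.mem_cons, List.mem_ofFn] at hg
    rcases hg with rfl | ⟨l, rfl⟩
    · rw [eval_elemInGate, eval_elemInGate]
    · rw [eval_elemCGate, eval_elemCGate]

/-- Values of the input gates (no prefix). -/
theorem gateValues_elemGates (v : MatMulVars n) (c : ℂ) : gateValues (elemGates v c) = elemVals v c :=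
  gateValues_append_elemGates [] v c

/-! ## Elementary translations: the substitution -/

/-- The operand substituted for each variable in an elementary translation at `v`: the moved
variables read the input gates (indices `0`, `1 + l`), the others stay. -/
def elemRho : MatMulVars n → GraphVars n → Operand ℂ (GraphVars n)
  | v, Sum.inl w => if w = v then .gate 0 else .var (Sum.inl w)
  | Sum.inl (i, _), Sum.inr (i', l) => if i' = i then .gate (1 + (l : ℕ)) else .var (Sum.inr (i', l))
  | Sum.inr (_, l), Sum.inr (i, l') => if l' = l then .gate (1 + (i : ℕ)) else .var (Sum.inr (i, l'))

/-- Reading the input gate `0` off the values. -/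
theorem getD_elemVals_zero (v : MatMulVars n) (c : ℂ) (ws : List (MvPolynomial (GraphVars n) ℂ)) :
    (elemVals v c ++ ws).getD 0 0 = X (Sum.inl v) + C c := by
  simp [elemVals]

/-- Reading the input gate `1 + l` off the values. -/
theorem getD_elemVals_succ (v : MatMulVars n) (c : ℂ) (l : Fin n) (ws : List (MvPolynomial (GraphVars n) ℂ)) :
    (elemVals v c ++ ws).getD (1 + (l : ℕ)) 0 = elemCVal v c l := by
  rw [Nat.add_comm, elemVals, List.cons_append, List.getD_cons_succ,
    List.getD_append _ _ _ _ (by simp), List.getD_eq_getElem _ _ (by simp), List.getElem_ofFn]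

/-- The shift at an elementary graph point, `(A,B)`-coordinates. -/
theorem shift_graphPoint_single_inl (v w : MatMulVars n) (c : ℂ) :
    shift (graphPoint (Pi.single v c)) (Sum.inl w) =
      if w = v then X (Sum.inl v) + C c else X (Sum.inl w) := by
  by_cases h : w = v
  · subst h; simp [shift, graphPoint]
  · simp [shift, graphPoint, h]

/-- The shift at the elementary graph point `c·e_{a_{ik}}`, `c`-coordinates. -/
theorem shift_graphPoint_single_inr_inl (i k : Fin n) (c : ℂ) (i' l : Fin n) :
    shift (graphPoint (Pi.single (Sum.inl (i, k) : MatMulVars n) c)) (Sum.inr (i', l)) =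
      if i' = i then elemCVal (Sum.inl (i, k)) c l else X (Sum.inr (i', l)) := by
  by_cases h : i' = i
  · subst h
    simp [shift, graphPoint, Pi.single_apply, elemCVal, Finset.sum_ite_eq', ite_smul]
  · simp [shift, graphPoint, h]

/-- The shift at the elementary graph point `c·e_{b_{kl}}`, `c`-coordinates. -/
theorem shift_graphPoint_single_inr_inr (k l : Fin n) (c : ℂ) (i l' : Fin n) :
    shift (graphPoint (Pi.single (Sum.inr (k, l) : MatMulVars n) c)) (Sum.inr (i, l')) =
      if l' = l then elemCVal (Sum.inr (k, l)) c i else X (Sum.inr (i, l')) := by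
  by_cases h : l' = l
  · subst h
    simp [shift, graphPoint, Pi.single_apply, elemCVal, Finset.sum_ite_eq', ite_smul]
  · simp [shift, graphPoint, h]

/-- **The substitution reads the elementary shift**: `ρ_v u` evaluates, against the values of the
input gates followed by anything, to `θ_{graphPoint (c e_v)} u`. -/
theorem eval_elemRho (v : MatMulVars n) (c : ℂ) (u : GraphVars n) (ws : List (MvPolynomial (GraphVars n) ℂ)) :
    (elemRho v u).eval (gateValues (elemGates v c) ++ ws) = shift (graphPoint (Pi.single v c)) u := by
  rw [gateValues_elemGates]
  rcases u with w | ⟨i', l'⟩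
  · rw [shift_graphPoint_single_inl]
    simp only [elemRho]
    split_ifs with h
    · exact getD_elemVals_zero v c ws
    · rfl
  · rcases v with ⟨i, k⟩ | ⟨k, l⟩
    · rw [shift_graphPoint_single_inr_inl]
      simp only [elemRho]
      split_ifs with h
      · exact getD_elemVals_succ _ c l' ws
      · rfl
    · rw [shift_graphPoint_single_inr_inr]
      simp only [elemRho]
      split_ifs with h
      · exact getD_elemVals_succ _ c i' ws
      · rfl

/-! ## Substituted programs: values -/

/-- **Gate values of a substitution circuit** (the tree's `eval_substCircuit`, all gates): the prefix
values followed by the `aeval h`-images of the values of `P`. -/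
theorem gateValues_substCircuit_gates (P : ArithCircuit ℂ (GraphVars n)) (pre : List (Gate ℂ (GraphVars n)))
    {ρ : GraphVars n → Operand ℂ (GraphVars n)} {h : GraphVars n → MvPolynomial (GraphVars n) ℂ}
    (hρ : ∀ i ws, (ρ i).eval (gateValues pre ++ ws) = h i) :
    gateValues (P.substCircuit pre ρ).gates = gateValues pre ++ (gateValues P.gates).map (aeval h) := by
  have hlen : pre.length = (gateValues pre).length := (gateValues_length (k := ℂ) pre).symm
  show gateValues (pre ++ P.gates.map (Gate.subst ρ pre.length)) = _
  unfold gateValues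
  rw [List.foldl_append, hlen]
  have := foldl_subst (k := ℂ) hρ P.gates []
  simpa [gateValues] using this

/-- Reading an `aeval h`-mapped value list (junk `0 ↦ 0`). -/
theorem getD_map_aeval (h : GraphVars n → MvPolynomial (GraphVars n) ℂ)
    (l : List (MvPolynomial (GraphVars n) ℂ)) (i : ℕ) :
    (l.map (aeval (R := ℂ) h)).getD i 0 = aeval h (l.getD i 0) := by
  simp only [List.getD_eq_getElem?_getD, List.getElem?_map]
  cases l[i]? <;> simp

/-! ## The translated program of one base translation -/

/-- The program of `P` translated by the elementary pieces `L = [(v₁,c₁), …]` (composed right to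
left: the head is applied last). -/
def translCircuit (P : ArithCircuit ℂ (GraphVars n)) : List (MatMulVars n × ℂ) → ArithCircuit ℂ (GraphVars n)
  | [] => P
  | vc :: L => (translCircuit P L).substCircuit (elemGates vc.1 vc.2) (elemRho vc.1)

/-- The base translation of a list of elementary pieces. -/
def deltaOf (L : List (MatMulVars n × ℂ)) : MatMulVars n → ℂ :=
  (L.map fun vc => (Pi.single vc.1 vc.2 : MatMulVars n → ℂ)).sum

/-- No piece: the zero translation. -/
@[simp] theorem deltaOf_nil : deltaOf ([] : List (MatMulVars n × ℂ)) = 0 := rfl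

/-- One more piece. -/
theorem deltaOf_cons (vc : MatMulVars n × ℂ) (L : List (MatMulVars n × ℂ)) :
    deltaOf (vc :: L) = Pi.single vc.1 vc.2 + deltaOf L := by
  simp [deltaOf]

/-- Size of the translated program: `(n+1)·|L| + |P|`. -/
theorem size_translCircuit (P : ArithCircuit ℂ (GraphVars n)) (L : List (MatMulVars n × ℂ)) :
    (translCircuit P L).size = (n + 1) * L.length + P.size := by
  induction L with
  | nil => simp [translCircuit]
  | cons vc L ih =>
    simp only [translCircuit, size_substCircuit, length_elemGates, ih, List.length_cons]
    ring

/-- The translated program has fan-in two. -/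
theorem isFanInTwo_translCircuit {P : ArithCircuit ℂ (GraphVars n)} (hP : P.IsFanInTwo)
    (L : List (MatMulVars n × ℂ)) : (translCircuit P L).IsFanInTwo := by
  induction L with
  | nil => simpa [translCircuit] using hP
  | cons vc L ih => exact ih.substCircuit (fanIn_elemGates vc.1 vc.2) _

/-- **Values of the translated program**: the last `|P|` gates hold the `deltaOf L`-translates of
the values of `P`. -/
theorem getD_gateValues_translCircuit (P : ArithCircuit ℂ (GraphVars n)) (L : List (MatMulVars n × ℂ)) (j : ℕ) :
    (gateValues (translCircuit P L).gates).getD ((n + 1) * L.length + j) 0 =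
      translate (deltaOf L) ((gateValues P.gates).getD j 0) := by
  induction L with
  | nil => simp [translCircuit, translate_zero]
  | cons vc L ih =>
    have hle : (gateValues (elemGates vc.1 vc.2)).length ≤ (n + 1) * (vc :: L).length + j := by
      simp only [gateValues_length, length_elemGates, List.length_cons]
      nlinarith
    rw [translCircuit, gateValues_substCircuit_gates _ _ (eval_elemRho vc.1 vc.2),
      List.getD_append_right _ _ _ _ hle, gateValues_length, length_elemGates,
      show (n + 1) * (vc :: L).length + j - (n + 1) = (n + 1) * L.length + j by
        simp only [List.length_cons]; rw [Nat.mul_succ]; omega,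
      getD_map_aeval, ih, aeval_shift_graphPoint, translate_translate, deltaOf_cons,
      add_comm (deltaOf L)]

/-! ## The support decomposition of a base translation -/

/-- The elementary pieces of `δ`: one per entry of its support. -/
def supportList (δ : MatMulVars n → ℂ) : List (MatMulVars n × ℂ) :=
  ((Finset.univ.filter fun v => δ v ≠ 0).toList).map fun v => (v, δ v)

/-- The pieces sum to `δ`. -/
theorem deltaOf_supportList (δ : MatMulVars n → ℂ) : deltaOf (supportList δ) = δ := by
  funext w
  simp only [deltaOf, supportList, List.map_map, Function.comp_def]
  rw [Finset.sum_map_toList, Finset.sum_apply, Finset.sum_filter]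
  simp only [Pi.single_apply]
  rw [Finset.sum_eq_single w]
  · by_cases h : δ w = 0 <;> simp [h]
  · intro v _ hvw; simp [Ne.symm hvw]
  · simp

/-- Their number is the size of the support. -/
theorem length_supportList (δ : MatMulVars n → ℂ) : (supportList δ).length = (Function.support δ).ncard := by
  have h : Function.support δ = ↑(Finset.univ.filter fun v => δ v ≠ 0) := by
    ext v; simp [Function.mem_support]
  rw [h, Set.ncard_coe_finset]
  simp [supportList]

end Summit.MatrixMultiplication.MatrixMultiplication.Theorems.GraphEquations

end
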